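import Summits.Ventures.Crystal3D.Theorems.StickyWulffConstantCoaxialWallLawVicinalCore
import Summits.Ventures.Crystal3D.Theorems.StickyWulffConstantGenericWallFloorStackLedgerOneSidedWideWith
import Summits.Ventures.Crystal3D.Theorems.StickyWulffConstantCoaxialWallLawLedgerWithCharge
import HarnessLib

/-!
# Restatement programme, reach cone: the WIDE-TWIN path AT explicit constants (`R₀ = 10`)

HONEST FRAMING. Venture `Summits/Ventures/Crystal3D` (cell `crystal3d-full`); helper for the crux `TextureLiminf` (stmt-Ventures-19483,
line `TexShadow`) and lane F's debt F-U (cf-p1 DECISION (lxvii), 2026-08-29).  Rung credit only (census-free, standard axioms); F-C1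
not moved; E1 (`ExactOnly`) and `StarPairFar` stay BY NAME.  The links above leaf L3a (`twoSlabAdhesionWith_stackLedger_oneSided_wide`)
in the explicit-constant currency (proofs = the originals' in `…InPlaneStackWalkersWide` / `…VicinalCore`, `At` ↦ `With`):
`twoSlabLedgerWith_twin_inPlane_wide_of_inner_ge`, `coaxialOnWith_of_twin_wide` — ONE `C = (240√2π + 4440·42)/2 + 16000 + K`.
-/

noncomputable section

namespace Summit.Ventures.Crystal3D.Theorems

open Summit.Ventures.Crystal3D Finset
open Literature.MathematicalPhysics.StatisticalMechanics (fccStacking barlowStacking IsHaggSeq contactDeficiency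
  isHaggSeq_const)
open scoped InnerProductSpace

open scoped Classical in
/-- **Twin pair, any in-plane slot of grain 1 with `e₃`-component `≥ 9/20`, explicit constants**: `TwoSlabLedgerWith (c₀ + K) 10
((√2/2)⟪A₁d₁, e₃⟫)`, arbitrary fillings, modulo E1 and `StarPairFar`; one absolute `K`. -/
theorem twoSlabLedgerWith_twin_inPlane_wide_of_inner_ge : ∃ K : ℝ, ∀
    {s₀ : EuclideanSpace ℝ (Fin 3)} (_hs₀ : s₀ ∈ fccSlots)
    (_hcert : ExactOnly 0 (fccSlots.filter fun w => 0 < ⟪w, s₀⟫_ℝ)) (_hfar : StarPairFar)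
    (A₁ : EuclideanSpace ℝ (Fin 3) ≃ₗᵢ[ℝ] EuclideanSpace ℝ (Fin 3)) (t₁ : EuclideanSpace ℝ (Fin 3))
    (A₂ : EuclideanSpace ℝ (Fin 3) ≃ₗᵢ[ℝ] EuclideanSpace ℝ (Fin 3)) (t₂ : EuclideanSpace ℝ (Fin 3))
    {μ : EuclideanSpace ℝ (Fin 3)}
    (_hμ : ‖μ‖ = 1 ∧ ∀ w ∈ fccSlots, ⟪w, μ⟫_ℝ = 0 ∨ ⟪w, μ⟫_ℝ = Real.sqrt (2 / 3) ∨ ⟪w, μ⟫_ℝ = -Real.sqrt (2 / 3))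
    (_hA₂ : A₂ '' fccStacking 1 (Real.sqrt (2 / 3)) = (wordFrame A₁ [μ]) '' fccStacking 1 (Real.sqrt (2 / 3)))
    {d₁ : EuclideanSpace ℝ (Fin 3)} (_hd₁ : d₁ ∈ fccSlots) (_hplane : ⟪d₁, μ⟫_ℝ = 0)
    (_hup : (9 / 20 : ℝ) ≤ ⟪A₁ d₁, EuclideanSpace.single (2 : Fin 3) (1 : ℝ)⟫_ℝ),
    TwoSlabLedgerWith ((240 * Real.sqrt 2 * Real.pi + 4440 * (4 * 10 + 2)) / 2 + 16000 + K) 10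
      (Real.sqrt 2 * ⟪A₁ d₁, EuclideanSpace.single (2 : Fin 3) (1 : ℝ)⟫_ℝ / 2) A₁ t₁ A₂ t₂ := by
  obtain ⟨K, hK⟩ := twoSlabAdhesionWith_stackLedger_oneSided_wide
  refine ⟨K, ?_⟩
  intro s₀ hs₀ hcert hfar A₁ t₁ A₂ t₂ μ hμ hA₂ d₁ hd₁ hplane hup
  obtain ⟨z, hz, hze, hsteep⟩ := exists_tilt_vertical_wide
    (by rw [LinearIsometryEquiv.norm_map, norm_eq_one_of_mem_fccSlots hd₁]) hup
  have h := hK hs₀ hcert (doubleStarCoaxialAt_of_starPairFar hfar)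
    (capPairCoaxial_of_starPairFar hfar) A₁ t₁ A₂ t₂ hz hze hd₁ hsteep
    {F | ∃ stk : List WalkEntry, StackSound z stk ∧ StackWF z stk ∧ stk.getLast? = some ⟨A₁, d₁, 0⟩ ∧
      ∃ e ∈ stk, e.frame = F}
    (fun stk hS hW hlast e he => ⟨stk, hS, hW, hlast, e, he, rfl⟩)
    (fun _ ⟨_, hS, hW, hl, _, he, hF⟩ => by
      rw [← hF, hA₂]; exact image_ne_twin_of_inPlane_stack hμ hplane hS hW hl he)
  rwa [abs_of_nonneg (by linarith : (0 : ℝ) ≤ ⟪A₁ d₁, EuclideanSpace.single (2 : Fin 3) (1 : ℝ)⟫_ℝ)] at h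

open scoped Classical in
/-- **Wide twins at explicit constants** (`coaxialTwoSlabAdhesion_of_twin_wide` in the With-currency): a twin pair about a unit menu
normal `ν` of grain 1 with `(√3/2)·√(1 − ⟪ν, e₃⟫²) ≥ 9/20` ⇒ the conclusion of `CoaxialTwoSlabAdhesionOnWith (c₀ + K) 10` for the pair
(frame `L e₃ = ν`); one absolute `K`. -/
theorem coaxialOnWith_of_twin_wide : ∃ K : ℝ, ∀
    {s₀ : EuclideanSpace ℝ (Fin 3)} (_hs₀ : s₀ ∈ fccSlots)
    (_hcert : ExactOnly 0 (fccSlots.filter fun w => 0 < ⟪w, s₀⟫_ℝ)) (_hSP : StarPairFar)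
    (A₁ : EuclideanSpace ℝ (Fin 3) ≃ₗᵢ[ℝ] EuclideanSpace ℝ (Fin 3)) (t₁ : EuclideanSpace ℝ (Fin 3))
    (A₂ : EuclideanSpace ℝ (Fin 3) ≃ₗᵢ[ℝ] EuclideanSpace ℝ (Fin 3)) (t₂ : EuclideanSpace ℝ (Fin 3))
    {ν : EuclideanSpace ℝ (Fin 3)} (_hν : ‖ν‖ = 1)
    (_hmenu : ∀ w ∈ fccSlots, ⟪A₁ w, ν⟫_ℝ = 0 ∨ ⟪A₁ w, ν⟫_ℝ = Real.sqrt (2 / 3) ∨ ⟪A₁ w, ν⟫_ℝ = -Real.sqrt (2 / 3))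
    (_htwin : A₂ '' fccStacking 1 (Real.sqrt (2 / 3)) = twinFrame A₁ ν '' fccStacking 1 (Real.sqrt (2 / 3)))
    (_hwide : (9 / 20 : ℝ) ≤ Real.sqrt 3 / 2 * Real.sqrt (1 - ⟪ν, EuclideanSpace.single (2 : Fin 3) (1 : ℝ)⟫_ℝ ^ 2)),
    ∃ (L : EuclideanSpace ℝ (Fin 3) ≃ₗᵢ[ℝ] EuclideanSpace ℝ (Fin 3))
        (s₁ s₂ : EuclideanSpace ℝ (Fin 3)) (σ σ' : ℤ → ℤ), IsHaggSeq σ ∧ IsHaggSeq σ' ∧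
        (fun p => A₁ p + t₁) '' fccStacking 1 (Real.sqrt (2 / 3)) ⊆
          (fun p => L p + s₁) '' barlowStacking 1 (Real.sqrt (2 / 3)) σ ∧
        (fun p => A₂ p + t₂) '' fccStacking 1 (Real.sqrt (2 / 3)) ⊆
          (fun p => L p + s₂) '' barlowStacking 1 (Real.sqrt (2 / 3)) σ' ∧
        TwoSlabLedgerWith ((240 * Real.sqrt 2 * Real.pi + 4440 * (4 * 10 + 2)) / 2 + 16000 + K) 10
          ((1 / 2 : ℝ) * Real.sqrt (1 - ⟪L (EuclideanSpace.single (2 : Fin 3) (1 : ℝ)),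
            (EuclideanSpace.single (2 : Fin 3) (1 : ℝ))⟫_ℝ ^ 2)) A₁ t₁ A₂ t₂ := by
  obtain ⟨K, hK⟩ := twoSlabLedgerWith_twin_inPlane_wide_of_inner_ge
  refine ⟨K, ?_⟩
  intro s₀ hs₀ hcert hSP A₁ t₁ A₂ t₂ ν hν hmenu htwin hwide
  set e : EuclideanSpace ℝ (Fin 3) := EuclideanSpace.single (2 : Fin 3) (1 : ℝ) with he
  have hlt : ⟪ν, e⟫_ℝ ^ 2 < 1 := by
    by_contra hge
    push Not at hge
    have : Real.sqrt (1 - ⟪ν, e⟫_ℝ ^ 2) = 0 := Real.sqrt_eq_zero'.2 (by linarith)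
    rw [this, mul_zero] at hwide
    norm_num at hwide
  obtain ⟨w, hw, hwν, hwe⟩ := exists_inPlane_slot_ge_sin A₁ hν hmenu hlt
  have hup : (9 / 20 : ℝ) ≤ ⟪A₁ w, e⟫_ℝ := hwide.trans hwe
  set μ : EuclideanSpace ℝ (Fin 3) := A₁.symm ν with hμ
  have hμu : ‖μ‖ = 1 := by rw [hμ, LinearIsometryEquiv.norm_map, hν]
  have hμm : ∀ w ∈ fccSlots, ⟪w, μ⟫_ℝ = 0 ∨ ⟪w, μ⟫_ℝ = Real.sqrt (2 / 3) ∨ ⟪w, μ⟫_ℝ = -Real.sqrt (2 / 3) := by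
    intro w' hw'
    rw [hμ, ← LinearIsometryEquiv.inner_map_map A₁, LinearIsometryEquiv.apply_symm_apply]
    exact hmenu w' hw'
  have htw : twinFrame A₁ ν = wordFrame A₁ [μ] := by rw [twinFrame_eq_reflection_trans A₁ hν]; rfl
  have hA₂ : A₂ '' fccStacking 1 (Real.sqrt (2 / 3)) = (wordFrame A₁ [μ]) '' fccStacking 1 (Real.sqrt (2 / 3)) := by
    rw [htwin, htw]
  have hplane : ⟪w, μ⟫_ℝ = 0 := by
    rw [hμ, ← LinearIsometryEquiv.inner_map_map A₁, LinearIsometryEquiv.apply_symm_apply]; exact hwν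
  have hcell := hK hs₀ hcert hSP A₁ t₁ A₂ t₂ ⟨hμu, hμm⟩ hA₂ hw hplane hup
  obtain ⟨L, hLΛ, hLe⟩ := exists_frame_of_menu A₁ hν hmenu
  have hsub₂ := movedFcc_subset_frame_negConst (twin_image_eq_frame_negConst hν hLΛ hLe htwin) t₂
  refine coaxialOnWith_of_twoSlabLedgerWith_frame hcell L t₁ t₂ isHaggSeq_const isHaggSeq_negConst
    (movedFcc_subset_frame hLΛ t₁) hsub₂ ?_
  rw [hLe]
  have hsq0 : 0 ≤ Real.sqrt (1 - ⟪ν, e⟫_ℝ ^ 2) := Real.sqrt_nonneg _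
  have h6 := sqrt6_div_four_mul_le hwe
  have h62 : (2 : ℝ) ≤ Real.sqrt 6 := by
    rw [show (2 : ℝ) = Real.sqrt (2 ^ 2) by rw [Real.sqrt_sq (by norm_num)]]
    exact Real.sqrt_le_sqrt (by norm_num)
  nlinarith

end Summit.Ventures.Crystal3D.Theorems

end
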